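import Summits.QuantumFields.YangMills.Theorems.OnsetSkewLawOnsetVanishing
import HarnessLib

/-!
# Crux `OnsetSkewLaw.RPOnsetFloor` (stmt-QuantumFields-23138), LINE «FloorInheritance» (planner ym-idea-11 g13, registered
# skeleton `pub/ideators/ym-idea-11/g13/floor-inheritance.lean`, sha 8439a2dfecba): the registered stub `stub_uvQuiet` BY NAME

The line's lever (A) «UV atoms are quiet» — clause (ii) of `RPOnsetFloor` for EVERY compact simple `G`, lattice datum `r`,
compactly supported profile `b` and level `ε > 0` — is ALREADY a tree theorem:
`Summit.QuantumFields.YangMills.Theorems.OnsetSkewLawGlue.onsetVanishes` (file `OnsetSkewLawOnsetVanishing.lean`, width seat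
`ym-line-sfw-p2-w4`; mechanism: the volume-uniform weak-coupling plaquette floor `⟨(1/N) Re tr U_p⟩ ≥ 1 − η`, variance ≤ second
moment about `N`, one finite support box of atom weights).  This file records the registered stub statement `StubUVQuietP`
(with its `PartII`, verbatim from the skeleton; `E4` spelled `EuclideanSpace ℝ (Fin 4)`) and closes it by that theorem:
`stub_uvQuiet : StubUVQuietP` — the skeleton's `sorry` at `stub_uvQuiet` is discharged BY NAME (the simple-group hypothesis is
not even used).  Also the `let`-free form `partII_of_compactSupport`.

HONEST FRAMING: clause (ii) only; clause (i) (the floor, NT-class), `stub_singleSlot`, `stub_positiveTimeSynthesis`,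
`stub_floorInheritance` and the shared residual `OnsetFloors` are untouched; no summit, rung or crux is proved; the Yang–Mills
mass gap is NOT proved.  Cell `ym-idea-1`, width seat `ym-line-sfw-p2-w3` g33 (free hands). [folklore]
-/

set_option autoImplicit false

noncomputable section

open MeasureTheory
open Literature.MathematicalPhysics.QuantumFieldTheory Literature.MathematicalPhysics.QuantumLattice
open Summit.QuantumFields.YangMills.Theorems.InfiniteVolume Summit.QuantumFields.YangMills.Theorems.InfVolRP

namespace Summit.QuantumFields.YangMills.Theorems.RPOnsetFloorUVQuiet

/-- Part (ii) of the crux `RPOnsetFloor` for given `G, r, b, ε` — UV quietness of atoms of resolution `≥ s₀` (verbatim the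
skeleton's `PartII`, = the second conjunct of `OnsetSkewLaw.RPOnsetFloor`; a registered-stub copy, not a citable fact). -/
abbrev PartII (G : Type) [Group G] [TopologicalSpace G] [IsTopologicalGroup G] [CompactSpace G]
    [MeasurableSpace G] [BorelSpace G] (r : LatticeRep G) (b : SchwartzMap (EuclideanSpace ℝ (Fin 4)) ℝ) (ε : ℝ) : Prop :=
  ∀ s₀ : ℝ, 0 < s₀ → ∃ β₁ : ℝ, ∀ β : ℝ, β₁ ≤ β → ∀ μ ∈ oddTorusLimitPoints r β, let wt : Finset (Fin 4 × Fin 4) → ℝ → EuclideanSpace ℝ (Fin 4) → (Fin 4 × Fin 4) × (Fin 4 → ℤ) → ℝ := fun Q s y p => if p.1 ∈ Q ∧ p.1.1 < p.1.2 then b (s • (siteToE p.2 + centreOffset p.1) - y) else 0 ; let wr : Finset (Fin 4 × Fin 4) → ℝ → EuclideanSpace ℝ (Fin 4) → (Fin 4 × Fin 4) × (Fin 4 → ℤ) → ℝ := fun Q s y p => if p.1 ∈ Q ∧ p.1.1 < p.1.2 then b (timeReflection 4 (s • (siteToE p.2 + centreOffset p.1)) - y) else 0 ; let rpSq : Finset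 (Fin 4 × Fin 4) → ℝ → EuclideanSpace ℝ (Fin 4) → ℝ := fun Q s y => ∑' pp : ((Fin 4 × Fin 4) × (Fin 4 → ℤ)) × ((Fin 4 × Fin 4) × (Fin 4 → ℤ)), wr Q s y pp.1 * wt Q s y pp.2 * stateMomentStr G r μ 2 ![pp.1.1, pp.2.1] ![pp.1.2, pp.2.2] ; ∀ s : ℝ, s₀ ≤ s → ∀ (q : Fin 4 × Fin 4) (y : EuclideanSpace ℝ (Fin 4)), (∀ i, 0 ≤ y i ∧ y i ≤ s) → rpSq {q} s y < ε

/-- The registered stub statement `StubUVQuietP` of LINE «FloorInheritance» (verbatim): part (ii) for EVERY compact simple `G`,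
every `r`, every compactly supported `b`, every `ε > 0` (registered-stub copy, not a citable fact). -/
abbrev StubUVQuietP : Prop :=
  ∀ (G : Type) [Group G] [TopologicalSpace G] [IsTopologicalGroup G] [CompactSpace G],
    IsCompactSimpleLieGroup G →
    letI : MeasurableSpace G := borel G
    haveI : BorelSpace G := ⟨rfl⟩
    ∀ (r : LatticeRep G) (b : SchwartzMap (EuclideanSpace ℝ (Fin 4)) ℝ), HasCompactSupport b → ∀ ε : ℝ, 0 < ε → PartII G r b ε

/-- **`stub_uvQuiet` of LINE «FloorInheritance», BY NAME**: UV atoms are quiet — clause (ii) of `RPOnsetFloor` for every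
compact simple `G`, `r`, compactly supported `b`, `ε > 0`, by the tree's `OnsetSkewLawGlue.onsetVanishes`. [folklore] -/
theorem stub_uvQuiet : StubUVQuietP := by
  intro G _ _ _ _ _hG r b hb ε hε s₀ hs₀
  letI : MeasurableSpace G := borel G
  haveI : BorelSpace G := ⟨rfl⟩
  exact Summit.QuantumFields.YangMills.Theorems.OnsetSkewLawGlue.onsetVanishes r b hb hε s₀ hs₀

/-- The same with `PartII` unfolded and no simple-group hypothesis (any compact `G` with its Borel structure). [folklore] -/
theorem partII_of_compactSupport (G : Type) [Group G] [TopologicalSpace G] [IsTopologicalGroup G] [CompactSpace G]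
    [MeasurableSpace G] [BorelSpace G] (r : LatticeRep G) (b : SchwartzMap (EuclideanSpace ℝ (Fin 4)) ℝ)
    (hb : HasCompactSupport b) {ε : ℝ} (hε : 0 < ε) : PartII G r b ε := by
  intro s₀ hs₀
  exact Summit.QuantumFields.YangMills.Theorems.OnsetSkewLawGlue.onsetVanishes r b hb hε s₀ hs₀

end Summit.QuantumFields.YangMills.Theorems.RPOnsetFloorUVQuiet

end
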